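import Summits.ResolutionOfSingularities.ResolutionOfSingularities.Theorems.PurelyInseparableDim4ComponentThreads
import Summits.ResolutionOfSingularities.ResolutionOfSingularities.Theorems.PurelyInseparableDim4ScopeComponents
import Literature.AlgebraicGeometry.Resolution.CentreBlowupOrdAlongBasics
import HarnessLib

/-!
# [OURS · res-dim4-pi · F4-C] COMPONENT THREADS, part 3 — components = inclusion-minimal permissible
  coordinate centres ⊇ MODE-1h centres; every infinite branch of MODE 1h (indeed of ANY component rule)
  SWITCHES ITS CENTRE or MOVES IN THE FIBRE infinitely often

Cell `res-dim4-pi` (D-0157 DOOR 2, wave 2), seat `res-dim4-p-6` g2; corollaries of the TRANSVERSAL-THREAD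
FINITENESS theorem `ComponentThreads.noTransversalThread` (part 1, CARD I-2-6 of `res-dim4-idea-2`) in the
cell's vocabulary of record (`PIDim4.IsPermissibleCentre`, `PIDim4.IsMode1hCentre`, `CentreBlowup.step`).

* §1 **`isComponent_iff_minimal`** (`1 ≤ q`, `F ≠ 0`): `ComponentThreads.IsComponent q S F` (permissible, and
  no `C_{S∖k}` permissible) ⟺ `C_S` is permissible and INCLUSION-MINIMAL among the permissible coordinate
  centres (`∀ T ⊂ S, ¬ IsPermissibleCentre q T F` — the shape used by `ScopeComponents.minimal_of_isMode1hCentre`;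
  monotonicity `CentreBlowup.ordAlong_mono`); **`isComponent_of_isMode1hCentre`**: a MODE-1h centre (least
  cardinality = largest dimension) is a component.
* §2 **`no_component_tail`** / **`no_mode1h_tail`**: an infinite run of blow-ups `c (k+1) = step q S j_k b_k (c k)`
  with non-zero children cannot, from some time on, keep ONE centre `C_S` that is a component (resp. a MODE-1h
  centre) of every `c k` while all points satisfy `b_k|_S = 0` (no move in the fibre; moves ALONG `C_S` allowed).
* §3 **`exists_switch_or_fibre_move`** (the FINITE-SWITCHES residual of CARD I-2-6 §T3 in kernel form): along
  every infinite branch driven by centres `S_k` that are components of `c k` (in particular along every MODE-1h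
  branch, `exists_switch_or_fibre_move_of_mode1h`), beyond every time `N` there is an edge `k ≥ N` that
  SWITCHES the centre (`S (k+1) ≠ S k`) or MOVES IN THE FIBRE (`b_k i ≠ 0` for some `i ∈ S k`).  So an
  eventual F4-C letter only has to pay on centre switches and on fibre moves; the transversal steps in between
  are finite in number by part 1.
* §4 **`isComponent_iff_mem_minimalPrimes`** (clean `F ≠ 0` IN COORDINATE SCOPE, `q = p`): the thread
  components are EXACTLY the components `(x_S) ∈ Min J_p⁺(F)` of the `p`-fold locus through the point (g0's
  `PermissibleLocus.minimal_isPermissibleCentre_of_mem_minimalPrimes` / `span_X_mem_minimalPrimes_of_minimal`),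
  so CARD I-2-6's component rules and the F4-C scope game's component centres coincide in scope.

Scope (honest): statements about OUR frame; every `q ≥ 1`, every field; centre switches and fibre moves are NOT
bounded here (that is the open dim-4 content).  [OURS · counted 0 · elementary; AI kernel work, weaker than
expert review.]  NOTHING here is a statement about resolution of singularities; resolution in dimension `≥ 4` /
characteristic `p > 0` is NOT proved by anything in this file.  bears_on: LADDER-RESOLUTION:D157-DOOR2
(res-dim4-pi · F4-C component threads).  Host item (DR-157-C): `stmt-ResolutionOfSingularities-16155`, helper.
-/

noncomputable section

set_option linter.dupNamespace false -- mandated namespace of this single-conjunct summit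

open MvPolynomial Finset
open scoped BigOperators

namespace Summit.ResolutionOfSingularities.ResolutionOfSingularities.Theorems.PIDim4

namespace ComponentThreads

open Literature.AlgebraicGeometry.Resolution
open Literature.AlgebraicGeometry.Resolution.Hauser2010

variable {K : Type} [Field K]

/-! ## 1. Components are the inclusion-minimal permissible coordinate centres; MODE 1h picks components -/

/-- A component admits no permissible proper coordinate sub-centre: `IsComponent ⇒` inclusion-minimal
(monotonicity of `ord_{C_T}` in `T`, tree `CentreBlowup.ordAlong_mono`). OURS (elementary). [folklore] -/
theorem not_isPermissibleCentre_of_isComponent_of_ssubset {q : ℕ} {S T : Finset (Fin 4)}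
    {F : MvPolynomial (Fin 4) K} (hS : IsComponent q S F) (hTS : T ⊂ S) :
    ¬ IsPermissibleCentre q T F := by
  intro hT
  obtain ⟨k, hkS, hkT⟩ := Finset.exists_of_ssubset hTS
  have hTsub : T ⊆ S.erase k := fun i hi =>
    Finset.mem_erase.mpr ⟨fun h => hkT (h ▸ hi), hTS.1 hi⟩
  exact hS.2 k hkS (le_trans hT.2 (CentreBlowup.ordAlong_mono hTsub F))

/-- An inclusion-minimal permissible coordinate centre is a component (`1 ≤ q`, `F ≠ 0`: for a divisor
`S = {k}` the empty sub-centre has `ord = 0 < q`). OURS (elementary). [folklore] -/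
theorem isComponent_of_minimal {q : ℕ} (hq : 1 ≤ q) {S : Finset (Fin 4)} {F : MvPolynomial (Fin 4) K}
    (hF : F ≠ 0) (hS : IsPermissibleCentre q S F)
    (hmin : ∀ T : Finset (Fin 4), T ⊂ S → ¬ IsPermissibleCentre q T F) : IsComponent q S F := by
  refine ⟨hS, fun k hk hle => ?_⟩
  by_cases hne : (S.erase k).Nonempty
  · exact hmin (S.erase k) (Finset.erase_ssubset hk) ⟨hne, hle⟩
  · rw [Finset.not_nonempty_iff_eq_empty] at hne
    rw [hne, CentreBlowup.ordAlong_empty hF] at hle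
    have : (q : ℕ∞) ≤ 0 := hle
    exact absurd (by exact_mod_cast this : q ≤ 0) (by omega)

/-- **Components = inclusion-minimal permissible coordinate centres** (`1 ≤ q`, `F ≠ 0`). OURS
(elementary). [folklore] -/
theorem isComponent_iff_minimal {q : ℕ} (hq : 1 ≤ q) {S : Finset (Fin 4)} {F : MvPolynomial (Fin 4) K}
    (hF : F ≠ 0) :
    IsComponent q S F ↔
      IsPermissibleCentre q S F ∧ ∀ T : Finset (Fin 4), T ⊂ S → ¬ IsPermissibleCentre q T F :=
  ⟨fun h => ⟨h.1, fun _ hTS => not_isPermissibleCentre_of_isComponent_of_ssubset h hTS⟩,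
    fun h => isComponent_of_minimal hq hF h.1 h.2⟩

/-- **A MODE-1h centre is a component** (least cardinality ⇒ inclusion-minimal; `1 ≤ q`, `F ≠ 0`). OURS
(elementary). [folklore] -/
theorem isComponent_of_isMode1hCentre {q : ℕ} (hq : 1 ≤ q) {S : Finset (Fin 4)}
    {F : MvPolynomial (Fin 4) K} (hF : F ≠ 0) (h : IsMode1hCentre q S F) : IsComponent q S F :=
  isComponent_of_minimal hq hF h.1 fun T hTS hT =>
    absurd (h.2 T hT) (not_le.mpr (Finset.card_lt_card hTS))

/-! ## 2. No eventual transversal thread under MODE 1h / under any component rule -/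

section Tail

variable [DecidableEq K]

/-- the step of the zero datum is zero. OURS (elementary). [folklore] -/
theorem step_F_eq_zero_of_eq_zero (q : ℕ) (S : Finset (Fin 4)) (j : Fin 4) (b : Fin 4 → K)
    (s : State K) (hs : s.F = 0) : (CentreBlowup.step q S j b s).F = 0 := by
  change deletePthPowers q (PointBlowup.translate b (CentreBlowup.chartTransform q S j s.F)) = 0
  rw [hs, CentreBlowup.chartTransform_zero]
  unfold PointBlowup.translate
  rw [map_zero, deletePthPowers_zero]

/-- a non-zero child has a non-zero parent. OURS (elementary). [folklore] -/
theorem F_ne_zero_of_step_F_ne_zero {q : ℕ} {S : Finset (Fin 4)} {j : Fin 4} {b : Fin 4 → K}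
    {s : State K} (h : (CentreBlowup.step q S j b s).F ≠ 0) : s.F ≠ 0 :=
  fun hs => h (step_F_eq_zero_of_eq_zero q S j b s hs)

/-- **No eventual transversal thread along a component** (explicit edge data): an infinite run
`c (k+1) = step q S (j k) (b k) (c k)` with non-zero children cannot, from time `N` on, have `C_S` a
permissible INCLUSION-MINIMAL coordinate centre of every `c k` while `b k|_S = 0` (`1 ≤ q`).  The tree's
`noTransversalTail` with §1. OURS. [folklore] -/
theorem no_component_tail (q : ℕ) (hq : 1 ≤ q) (S : Finset (Fin 4)) (c : ℕ → State K) (N : ℕ)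
    (h : ∀ k, N ≤ k → IsPermissibleCentre q S (c k).F ∧
      (∀ T : Finset (Fin 4), T ⊂ S → ¬ IsPermissibleCentre q T (c k).F) ∧
      ∃ (j : Fin 4) (b : Fin 4 → K), j ∈ S ∧ (∀ i ∈ S, b i = 0) ∧
        (CentreBlowup.step q S j b (c k)).F ≠ 0 ∧ c (k + 1) = CentreBlowup.step q S j b (c k)) :
    False := by
  have h' : ∀ k, ∃ (j : Fin 4) (b : Fin 4 → K), j ∈ S ∧ (∀ i ∈ S, b i = 0) ∧
      (CentreBlowup.step q S j b (c (N + k))).F ≠ 0 ∧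
      c (N + k + 1) = CentreBlowup.step q S j b (c (N + k)) :=
    fun k => (h (N + k) (Nat.le_add_right N k)).2.2
  choose j b hj hb hne hstep using h'
  apply noTransversalThread q K S
  refine ⟨fun k => c (N + k), j, b, fun k => ⟨hj k, hb k, ?_, ?_⟩⟩
  · obtain ⟨hperm, hmin, -⟩ := h (N + k) (Nat.le_add_right N k)
    exact isComponent_of_minimal hq (F_ne_zero_of_step_F_ne_zero (hne k)) hperm hmin
  · show c (N + (k + 1)) = _
    rw [← Nat.add_assoc]
    exact hstep k

/-- **No eventual transversal thread under MODE 1h**: an infinite run `c (k+1) = step q S (j k) (b k) (c k)`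
with non-zero children cannot, from time `N` on, keep ONE centre `C_S` that is a MODE-1h centre of every
`c k` (least cardinality among the permissible coordinate centres) while every point satisfies `b k|_S = 0`
(`1 ≤ q`; every field). OURS. [folklore] -/
theorem no_mode1h_tail (q : ℕ) (hq : 1 ≤ q) (S : Finset (Fin 4)) (c : ℕ → State K) (N : ℕ)
    (h : ∀ k, N ≤ k → IsMode1hCentre q S (c k).F ∧
      ∃ (j : Fin 4) (b : Fin 4 → K), j ∈ S ∧ (∀ i ∈ S, b i = 0) ∧
        (CentreBlowup.step q S j b (c k)).F ≠ 0 ∧ c (k + 1) = CentreBlowup.step q S j b (c k)) :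
    False := by
  refine no_component_tail q hq S c N fun k hk => ?_
  obtain ⟨h1h, hrest⟩ := h k hk
  exact ⟨h1h.1, fun T hTS hT => absurd (h1h.2 T hT) (not_le.mpr (Finset.card_lt_card hTS)), hrest⟩

end Tail

/-! ## 3. FINITE-SWITCHES is the residual: every infinite component-rule branch switches its centre or
moves in the fibre infinitely often -/

section Switch

variable [DecidableEq K]

/-- **Every infinite branch driven by components SWITCHES ITS CENTRE or MOVES IN THE FIBRE beyond every
time.**  Data: states `c k`, centres `S k`, charts `j k ∈ S k`, points `b k` with
`c (k+1) = step q (S k) (j k) (b k) (c k) ≠ 0`, each `C_{S k}` a permissible inclusion-minimal coordinate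
centre of `c k` (`1 ≤ q`).  Then for every `N` some `k ≥ N` has `S (k+1) ≠ S k` or `b k i ≠ 0` for some
`i ∈ S k`. OURS. [folklore] -/
theorem exists_switch_or_fibre_move (q : ℕ) (hq : 1 ≤ q) (c : ℕ → State K) (S : ℕ → Finset (Fin 4))
    (j : ℕ → Fin 4) (b : ℕ → Fin 4 → K)
    (hperm : ∀ k, IsPermissibleCentre q (S k) (c k).F)
    (hmin : ∀ k (T : Finset (Fin 4)), T ⊂ S k → ¬ IsPermissibleCentre q T (c k).F)
    (hj : ∀ k, j k ∈ S k) (hne : ∀ k, (CentreBlowup.step q (S k) (j k) (b k) (c k)).F ≠ 0)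
    (hstep : ∀ k, c (k + 1) = CentreBlowup.step q (S k) (j k) (b k) (c k)) (N : ℕ) :
    ∃ k, N ≤ k ∧ (S (k + 1) ≠ S k ∨ ∃ i ∈ S k, b k i ≠ 0) := by
  by_contra hno
  -- from `N` on the centre is constant `= S N` and no point moves in the fibre
  have hno' : ∀ k, N ≤ k → S (k + 1) = S k ∧ ∀ i ∈ S k, b k i = 0 := by
    intro k hk
    by_contra h'
    refine hno ⟨k, hk, ?_⟩
    by_cases hS : S (k + 1) = S k
    · right
      by_contra h''
      exact h' ⟨hS, fun i hi => by_contra fun hb => h'' ⟨i, hi, hb⟩⟩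
    · exact Or.inl hS
  have hconst : ∀ k, N ≤ k → S k = S N := by
    intro k hk
    induction k with
    | zero =>
      obtain rfl : N = 0 := Nat.le_zero.mp hk
      rfl
    | succ m ih =>
      rcases Nat.lt_or_ge m N with hlt | hle
      · have : N = m + 1 := le_antisymm hk hlt
        rw [this]
      · rw [(hno' m hle).1, ih hle]
  refine no_component_tail q hq (S N) c N fun k hk => ?_
  rw [← hconst k hk]
  exact ⟨hperm k, hmin k, j k, b k, hj k, (hno' k hk).2, hne k, hstep k⟩

/-- **MODE-1h form**: along every infinite MODE-1h-driven branch (centres `S k` of least cardinality among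
the permissible coordinate centres of `c k`, charts `j k ∈ S k`, points `b k`, non-zero children), beyond
every time some edge SWITCHES the centre or MOVES IN THE FIBRE (`1 ≤ q`; every field). OURS. [folklore] -/
theorem exists_switch_or_fibre_move_of_mode1h (q : ℕ) (hq : 1 ≤ q) (c : ℕ → State K)
    (S : ℕ → Finset (Fin 4)) (j : ℕ → Fin 4) (b : ℕ → Fin 4 → K)
    (h1h : ∀ k, IsMode1hCentre q (S k) (c k).F) (hj : ∀ k, j k ∈ S k)
    (hne : ∀ k, (CentreBlowup.step q (S k) (j k) (b k) (c k)).F ≠ 0)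
    (hstep : ∀ k, c (k + 1) = CentreBlowup.step q (S k) (j k) (b k) (c k)) (N : ℕ) :
    ∃ k, N ≤ k ∧ (S (k + 1) ≠ S k ∨ ∃ i ∈ S k, b k i ≠ 0) :=
  exists_switch_or_fibre_move q hq c S j b (fun k => (h1h k).1)
    (fun k T hTS hT => absurd ((h1h k).2 T hT) (not_le.mpr (Finset.card_lt_card hTS))) hj hne hstep N

end Switch

/-! ## 4. In coordinate scope the thread components ARE the components of the `p`-fold locus -/

section Scope

/-- **A coordinate component of the `p`-fold locus is a thread component** (clean `F ≠ 0`, `q = p`; no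
scope hypothesis): if `(x_S)` is a minimal prime of `J_p⁺(F)` then `IsComponent p S F` — g0's
`PermissibleLocus.minimal_isPermissibleCentre_of_mem_minimalPrimes` + §1. OURS. [folklore] -/
theorem isComponent_of_mem_minimalPrimes (p : ℕ) [Fact p.Prime] [CharP K p]
    {F : MvPolynomial (Fin 4) K} (hclean : deletePthPowers p F = F) (hF : F ≠ 0) {S : Finset (Fin 4)}
    (hS : Ideal.span ((fun i => (X i : MvPolynomial (Fin 4) K)) '' (S : Set (Fin 4))) ∈
      (singLocusIdeal p F).minimalPrimes) : IsComponent p S F :=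
  have h := PermissibleLocus.minimal_isPermissibleCentre_of_mem_minimalPrimes p hclean hF hS
  isComponent_of_minimal (Fact.out : p.Prime).one_lt.le hF h.1 h.2

/-- **In scope, a thread component is a component of the `p`-fold locus** (clean `F ≠ 0` in coordinate
scope, `q = p`): `IsComponent p S F ⇒ (x_S) ∈ Min J_p⁺(F)` — g0's
`PermissibleLocus.span_X_mem_minimalPrimes_of_minimal` + §1. OURS. [folklore] -/
theorem span_X_mem_minimalPrimes_of_isComponent (p : ℕ) [Fact p.Prime] [CharP K p]
    {F : MvPolynomial (Fin 4) K} (hclean : deletePthPowers p F = F) (hF : F ≠ 0)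
    (hscope : InCoordinateScope p F) {S : Finset (Fin 4)} (hS : IsComponent p S F) :
    Ideal.span ((fun i => (X i : MvPolynomial (Fin 4) K)) '' (S : Set (Fin 4))) ∈
      (singLocusIdeal p F).minimalPrimes :=
  PermissibleLocus.span_X_mem_minimalPrimes_of_minimal p hclean hF hscope hS.1
    fun _ hTS => not_isPermissibleCentre_of_isComponent_of_ssubset hS hTS

/-- **IN COORDINATE SCOPE the thread components are EXACTLY the components of the `p`-fold locus through the
point** (clean `F ≠ 0`, `q = p`): `IsComponent p S F ⟺ (x_S) ∈ Min J_p⁺(F)`.  So in scope the component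
rules of CARD I-2-6 (threads along `IsComponent` centres) and the geometric (max-dimensional or arbitrary) component rules of the
F4-C scope game speak of the same centres. OURS. [folklore] -/
theorem isComponent_iff_mem_minimalPrimes (p : ℕ) [Fact p.Prime] [CharP K p]
    {F : MvPolynomial (Fin 4) K} (hclean : deletePthPowers p F = F) (hF : F ≠ 0)
    (hscope : InCoordinateScope p F) (S : Finset (Fin 4)) :
    IsComponent p S F ↔
      Ideal.span ((fun i => (X i : MvPolynomial (Fin 4) K)) '' (S : Set (Fin 4))) ∈
        (singLocusIdeal p F).minimalPrimes :=
  ⟨span_X_mem_minimalPrimes_of_isComponent p hclean hF hscope, isComponent_of_mem_minimalPrimes p hclean hF⟩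

end Scope

end ComponentThreads

end Summit.ResolutionOfSingularities.ResolutionOfSingularities.Theorems.PIDim4

end
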